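import Mathlib
import HarnessLib
import Summits.NavierStokesRegularity.NavierStokesRegularity.Theorems.PoloidalWindowDoorLrcModEntireTwistingTHFlatRidgeArcForm
import Summits.NavierStokesRegularity.NavierStokesRegularity.Theorems.PoloidalWindowDoorLrcModEntireTwistingTHFlatRidgeQuarticDefinite

/-!
# Item `LrcModEntire` (stmt-NavierStokesRegularity-20428) — THE FLAT SUB-CELL ALONG A HOT ARC: the LEAD lever's definiteness hypothesis DECIDED at every arc point

ns-k2-port-2 g7, helper of item 20428 (LEAD lineage ns-poloidal-K2-p3; `--supports stmt-NavierStokesRegularity-20428 --as helper`).  Sequel of `…FlatRidgeArcForm` (arc package: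
tangent kernel + signed expansion with one slope `μ₀`) and `…FlatRidgeQuarticDefinite` (`quartic_definite_iff`):

* ★ `arcQuarticDefinite_of_flatHotArc` — flat-cell binders VERBATIM + a differentiable unit-speed hot arc `γ ⊂ P₀`: ONE `μ₀ ≤ 0` such that for EVERY `s`, with `T = deriv γ s`,
  `ν = JT`, `y = γ s`, `F_s(n,z) = D⁴θ(y)[(nν+ze₂)⁴]`, `P(s) = D⁴[ν,ν,ν,ν]`, `B₃(s) = D⁴[ν,e₂,ν,ν]`:
  **`(∃ λ > 0, ∀ n z, λ(n⁴+z⁴) ≤ −σF_s(n,z)) ⟺ B₃(s)² < −μ₀P(s)²`** (the hypothesis `λ_s(n⁴+z⁴) ≤ Q_s` of LEAD g15's `…FlatSeparation` / `…FlatLeverPointwise`, decided by two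
  numbers), and at equality `B₃(s)² = −μ₀P(s)²` the null line `F_s(−B₃t, Pt) = 0`;
* class-free two-sided bounds for the lever's transversal minimum `m(s) = min_η Q_s(η,1)` in terms of `p = −σP`, `B₃`, `c₀ = −μ₀`:
  `c₀(c₀p² − B₃²)/(24p) ≤ m ≤ c₀²p/24` (`oddQuartic_sq_le_of_form`, `quartic_height_one_lower`, `quartic_height_one_at_zero`; equality throughout iff `B₃ = 0`).

WHAT THIS IS NOT: not a claim about Navier–Stokes regularity and not a proof of `stub_T2bFlat` (bears_on LADDER-NS N0, item 20428 / crux 19708; OPEN).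
-/

set_option linter.style.longLine false
set_option linter.dupNamespace false

namespace Summit.NavierStokesRegularity.NavierStokesRegularity.Theorems.PoloidalWindowDoorLrcModEntireTwistingTHFlatRidgeArcDefinite

open Set Function Filter Topology Metric
open scoped RealInnerProductSpace InnerProductSpace ContDiff
open Literature.Analysis Literature.Analysis.FluidPDE Literature.Analysis.UnboundedOperators
open Summit.NavierStokesRegularity.NavierStokesRegularity.Theorems
open Summit.NavierStokesRegularity.NavierStokesRegularity.Theorems.LocalSineTubeDoorProfileAlignedWindowRigidityAncient
open Summit.NavierStokesRegularity.NavierStokesRegularity.Theorems.PoloidalWindowDoorLrcModEntireTwistingTHFlatRidgeQuarticDefinite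
open Summit.NavierStokesRegularity.NavierStokesRegularity.Theorems.PoloidalWindowDoorLrcModEntireTwistingTHFlatRidgeArcForm

/-! ### Class-free: two-sided bounds for the lever's transversal minimum `m = min_η Q(η,1)` -/

section ClassFree

/-- **`B₃² ≤ −μ₀P²` always** (the landed bound `|B₃| ≤ √(−μ₀)(−σP)` of `…QuarticForm.abs_oddQuartic_le_of_form`, squared). -/
theorem oddQuartic_sq_le_of_form {σ P B₃ μ₀ : ℝ} (hσ : σ = 1 ∨ σ = -1) (hμ : μ₀ ≤ 0)
    (hform : ∀ n z : ℝ, σ * (P * (n ^ 4 - 6 * μ₀ * (n ^ 2 * z ^ 2) + μ₀ ^ 2 * z ^ 4) + B₃ * (4 * (n ^ 3 * z) - 4 * μ₀ * (n * z ^ 3))) ≤ 0) :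
    B₃ ^ 2 ≤ -μ₀ * P ^ 2 := by
  have hb := PoloidalWindowDoorLrcModEntireTwistingTHFlatRidgeQuarticForm.abs_oddQuartic_le_of_form hσ hμ hform
  have hσP : σ * P ≤ 0 := by simpa using hform 1 0
  have hsq : |B₃| ^ 2 ≤ (Real.sqrt (-μ₀) * -(σ * P)) ^ 2 := pow_le_pow_left₀ (abs_nonneg _) hb 2
  have hσ2 : σ ^ 2 = 1 := by rcases hσ with rfl | rfl <;> norm_num
  rw [sq_abs, mul_pow, Real.sq_sqrt (by linarith)] at hsq
  nlinarith [hsq, hσ2]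

/-- **Lower bound for the transversal quartic at height `z = 1`, uniformly in `η`** (division-free): `(−μ₀P² − B₃²)(−μ₀) ≤ (−σP)·(−σF(η,1))`.  With `Q(η,1) = −σF(η,1)/24`,
`p = −σP > 0`, `c₀ = −μ₀`: the lever's minimum satisfies `m ≥ c₀(c₀p² − B₃²)/(24p)` (from the SOS identity of `…QuarticDefinite`, `(η² + c₀)² ≥ c₀²`). [folklore] -/
theorem quartic_height_one_lower {σ P B₃ μ₀ : ℝ} (hσ : σ = 1 ∨ σ = -1) (hμ : μ₀ ≤ 0)
    (hform : ∀ n z : ℝ, σ * (P * (n ^ 4 - 6 * μ₀ * (n ^ 2 * z ^ 2) + μ₀ ^ 2 * z ^ 4) + B₃ * (4 * (n ^ 3 * z) - 4 * μ₀ * (n * z ^ 3))) ≤ 0) (η : ℝ) :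
    (-μ₀ * P ^ 2 - B₃ ^ 2) * (-μ₀) ≤
      (-(σ * P)) * (-(σ * (P * (η ^ 4 - 6 * μ₀ * (η ^ 2 * 1 ^ 2) + μ₀ ^ 2 * 1 ^ 4) + B₃ * (4 * (η ^ 3 * 1) - 4 * μ₀ * (η * 1 ^ 3))))) := by
  have hδ : 0 ≤ -μ₀ * P ^ 2 - B₃ ^ 2 := by linarith [oddQuartic_sq_le_of_form hσ hμ hform]
  have hσP : σ * P ≤ 0 := by simpa using hform 1 0
  have hp : 0 ≤ -(σ * P) := by linarith
  have hF : 0 ≤ -(σ * (P * (η ^ 4 - 6 * μ₀ * (η ^ 2 * 1 ^ 2) + μ₀ ^ 2 * 1 ^ 4) + B₃ * (4 * (η ^ 3 * 1) - 4 * μ₀ * (η * 1 ^ 3)))) := by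
    linarith [hform η 1]
  rcases eq_or_lt_of_le hμ with h0 | hneg
  · -- `μ₀ = 0`: the left side vanishes
    have hl : (-μ₀ * P ^ 2 - B₃ ^ 2) * (-μ₀) = 0 := by rw [h0]; ring
    rw [hl]
    exact mul_nonneg hp hF
  · have hc0 : 0 < -μ₀ := by linarith
    have hid := quartic_sos_identity hσ P B₃ μ₀ η 1
    -- `p c₀ (−σF) ≥ δ (η² + c₀)² ≥ δ c₀²`
    have hA : (-μ₀) ^ 2 ≤ (η ^ 2 - μ₀ * 1 ^ 2) ^ 2 := by nlinarith [sq_nonneg η, hc0]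
    have h1 : (-μ₀ * P ^ 2 - B₃ ^ 2) * (-μ₀) ^ 2 ≤ (-(σ * P)) * (-μ₀) *
        (-(σ * (P * (η ^ 4 - 6 * μ₀ * (η ^ 2 * 1 ^ 2) + μ₀ ^ 2 * 1 ^ 4) + B₃ * (4 * (η ^ 3 * 1) - 4 * μ₀ * (η * 1 ^ 3))))) := by
      rw [hid]
      nlinarith [mul_le_mul_of_nonneg_left hA hδ, sq_nonneg (2 * (-(σ * P)) * (-μ₀) * (η * 1) - σ * B₃ * (η ^ 2 - μ₀ * 1 ^ 2))]
    -- divide by `c₀ > 0`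
    have h2 : (-μ₀) * ((-μ₀ * P ^ 2 - B₃ ^ 2) * (-μ₀)) ≤ (-μ₀) * ((-(σ * P)) *
        (-(σ * (P * (η ^ 4 - 6 * μ₀ * (η ^ 2 * 1 ^ 2) + μ₀ ^ 2 * 1 ^ 4) + B₃ * (4 * (η ^ 3 * 1) - 4 * μ₀ * (η * 1 ^ 3)))))) := by
      nlinarith [h1]
    exact le_of_mul_le_mul_left h2 hc0

/-- **The value at `η = 0`, height `1`**: `−σF(0,1) = (−σP)·μ₀²`, so the lever's minimum satisfies `m ≤ c₀²p/24` — and `m = c₀²p/24` exactly when `B₃ = 0` (then the lower bound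
coincides). [folklore] -/
theorem quartic_height_one_at_zero (σ P B₃ μ₀ : ℝ) :
    -(σ * (P * ((0 : ℝ) ^ 4 - 6 * μ₀ * ((0 : ℝ) ^ 2 * 1 ^ 2) + μ₀ ^ 2 * 1 ^ 4) + B₃ * (4 * ((0 : ℝ) ^ 3 * 1) - 4 * μ₀ * (0 * 1 ^ 3)))) = (-(σ * P)) * μ₀ ^ 2 := by
  ring

end ClassFree

variable {C : ℝ} {v : ℝ → EuclideanSpace ℝ (Fin 3) → EuclideanSpace ℝ (Fin 3)}

/-- ★ **THE LEAD LEVER'S DEFINITENESS HYPOTHESIS, DECIDED ALONG A FLAT HOT ARC.**  See the module docstring. -/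
theorem arcQuarticDefinite_of_flatHotArc (hdec : HasTypeITimeDecay C v) (hcont : ContinuousOn (uncurry v) (Iio (0 : ℝ) ×ˢ univ))
    (hmild : ∀ s t : ℝ, s < t → t < 0 → ∀ x, v t x = heatExtension (v s) (t - s) x - oseenDuhamel 1 s v v t x)
    (hdiv : ∀ t < 0, VectorCalculus.IsDivFree (v t))
    (hpol : ∀ s < 0, ∀ y, ⟪curl (v s) y, EuclideanSpace.single 2 1⟫_ℝ = 0)
    (hTH : ∀ t < 0, ∀ x x' : EuclideanSpace ℝ (Fin 3), x 2 = x' 2 → ∀ b c : Fin 3, b ≠ 2 → c ≠ 2 →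
      fderiv ℝ (v t) x (EuclideanSpace.single 2 1) b * fderiv ℝ (v t) x' (EuclideanSpace.single c 1) 2 =
        fderiv ℝ (v t) x' (EuclideanSpace.single 2 1) c * fderiv ℝ (v t) x (EuclideanSpace.single b 1) 2)
    (hne : v (-1) 0 2 ≠ 0) (hhot : ∀ t < 0, ∀ x, Real.sqrt (-t) * |v t x 2| ≤ |v (-1) 0 2|)
    (hproper : ∀ y ∈ {y : EuclideanSpace ℝ (Fin 3) | y 2 = 0 ∧ v (-1) y 2 = v (-1) 0 2}, ∀ r : ℝ, 0 < r →
      ∃ y' : EuclideanSpace ℝ (Fin 3), y' 2 = 0 ∧ dist y' y < r ∧ v (-1) y' 2 ≠ v (-1) 0 2)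
    {σ : ℝ} (hσ : σ = 1 ∨ σ = -1) (hσN : σ * v (-1) 0 2 = |v (-1) 0 2|)
    (hflatAll : ∀ y : EuclideanSpace ℝ (Fin 3), y 2 = 0 → v (-1) y 2 = v (-1) 0 2 →
      fderiv ℝ (fderiv ℝ (fun x => σ * v (-1) x 2)) y (EuclideanSpace.single 0 1) (EuclideanSpace.single 0 1) +
        fderiv ℝ (fderiv ℝ (fun x => σ * v (-1) x 2)) y (EuclideanSpace.single 1 1) (EuclideanSpace.single 1 1) = 0)
    {γ : ℝ → EuclideanSpace ℝ (Fin 3)} (hγd : Differentiable ℝ γ) (hγ2 : ∀ s, γ s 2 = 0) (hγv : ∀ s, v (-1) (γ s) 2 = v (-1) 0 2)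
    (hunit : ∀ s, ‖deriv γ s‖ = 1) :
    ∃ μ₀ : ℝ, μ₀ ≤ 0 ∧ ∀ s : ℝ, ∀ T : EuclideanSpace ℝ (Fin 3), T = deriv γ s → ∀ y : EuclideanSpace ℝ (Fin 3), y = γ s →
      ((∃ lam : ℝ, 0 < lam ∧ ∀ n z : ℝ, lam * (n ^ 4 + z ^ 4) ≤ -(σ * fderiv ℝ (fderiv ℝ (fun x => fderiv ℝ (fderiv ℝ (fun x' => (v (-1) x' 2 : ℝ))) x (n • ((-T 1) • EuclideanSpace.single 0 (1 : ℝ) + T 0 • EuclideanSpace.single 1 (1 : ℝ)) + z • (EuclideanSpace.single 2 (1 : ℝ))) (n • ((-T 1) • EuclideanSpace.single 0 (1 : ℝ) + T 0 • EuclideanSpace.single 1 (1 : ℝ)) + z • (EuclideanSpace.single 2 (1 : ℝ))))) y (n • ((-T 1) • EuclideanSpace.single 0 (1 : ℝ) + T 0 • EuclideanSpace.single 1 (1 : ℝ)) + z • (EuclideanSpace.single 2 (1 : ℝ))) (n • ((-T 1) • EuclideanSpace.single 0 (1 : ℝ) + T 0 • EuclideanSpace.single 1 (1 : ℝ)) +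 z • (EuclideanSpace.single 2 (1 : ℝ))))) ↔
        fderiv ℝ (fderiv ℝ (fun x => fderiv ℝ (fderiv ℝ (fun x' => (v (-1) x' 2 : ℝ))) x ((-T 1) • EuclideanSpace.single 0 (1 : ℝ) + T 0 • EuclideanSpace.single 1 (1 : ℝ)) ((-T 1) • EuclideanSpace.single 0 (1 : ℝ) + T 0 • EuclideanSpace.single 1 (1 : ℝ)))) y ((-T 1) • EuclideanSpace.single 0 (1 : ℝ) + T 0 • EuclideanSpace.single 1 (1 : ℝ)) (EuclideanSpace.single 2 (1 : ℝ)) ^ 2 < -μ₀ * fderiv ℝ (fderiv ℝ (fun x => fderiv ℝ (fderiv ℝ (fun x' => (v (-1) x' 2 : ℝ))) x ((-T 1) • EuclideanSpace.single 0 (1 : ℝ) + T 0 • EuclideanSpace.single 1 (1 : ℝ)) ((-T 1) • EuclideanSpace.single 0 (1 : ℝ) + T 0 • EuclideanSpace.single 1 (1 : ℝ)))) y ((-T 1) • EuclideanSpace.single 0 (1 : ℝ) + T 0 • EuclideanSpace.single 1 (1 : ℝ)) ((-T 1) • EuclideanSpace.single 0 (1 : ℝ) + T 0 • EuclideanSpace.single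 1 (1 : ℝ)) ^ 2) ∧
      (fderiv ℝ (fderiv ℝ (fun x => fderiv ℝ (fderiv ℝ (fun x' => (v (-1) x' 2 : ℝ))) x ((-T 1) • EuclideanSpace.single 0 (1 : ℝ) + T 0 • EuclideanSpace.single 1 (1 : ℝ)) ((-T 1) • EuclideanSpace.single 0 (1 : ℝ) + T 0 • EuclideanSpace.single 1 (1 : ℝ)))) y ((-T 1) • EuclideanSpace.single 0 (1 : ℝ) + T 0 • EuclideanSpace.single 1 (1 : ℝ)) (EuclideanSpace.single 2 (1 : ℝ)) ^ 2 = -μ₀ * fderiv ℝ (fderiv ℝ (fun x => fderiv ℝ (fderiv ℝ (fun x' => (v (-1) x' 2 : ℝ))) x ((-T 1) • EuclideanSpace.single 0 (1 : ℝ) + T 0 • EuclideanSpace.single 1 (1 : ℝ)) ((-T 1) • EuclideanSpace.single 0 (1 : ℝ) + T 0 • EuclideanSpace.single 1 (1 : ℝ)))) y ((-T 1) • EuclideanSpace.single 0 (1 : ℝ) + T 0 • EuclideanSpace.single 1 (1 : ℝ)) ((-T 1) • EuclideanSpace.single 0 (1 : ℝ) + T 0 • EuclideanSpace.single 1 (1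 : ℝ)) ^ 2 →
        ∀ n z t : ℝ, n = -fderiv ℝ (fderiv ℝ (fun x => fderiv ℝ (fderiv ℝ (fun x' => (v (-1) x' 2 : ℝ))) x ((-T 1) • EuclideanSpace.single 0 (1 : ℝ) + T 0 • EuclideanSpace.single 1 (1 : ℝ)) ((-T 1) • EuclideanSpace.single 0 (1 : ℝ) + T 0 • EuclideanSpace.single 1 (1 : ℝ)))) y ((-T 1) • EuclideanSpace.single 0 (1 : ℝ) + T 0 • EuclideanSpace.single 1 (1 : ℝ)) (EuclideanSpace.single 2 (1 : ℝ)) * t → z = fderiv ℝ (fderiv ℝ (fun x => fderiv ℝ (fderiv ℝ (fun x' => (v (-1) x' 2 : ℝ))) x ((-T 1) • EuclideanSpace.single 0 (1 : ℝ) + T 0 • EuclideanSpace.single 1 (1 : ℝ)) ((-T 1) • EuclideanSpace.single 0 (1 : ℝ) + T 0 • EuclideanSpace.single 1 (1 : ℝ)))) y ((-T 1) • EuclideanSpace.single 0 (1 : ℝ) + T 0 • EuclideanSpace.single 1 (1 : ℝ)) ((-T 1) • EuclideanSpace.single 0 (1 : ℝ) + T 0 • EuclideanSpace.single 1 (1 :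 ℝ)) * t →
          fderiv ℝ (fderiv ℝ (fun x => fderiv ℝ (fderiv ℝ (fun x' => (v (-1) x' 2 : ℝ))) x (n • ((-T 1) • EuclideanSpace.single 0 (1 : ℝ) + T 0 • EuclideanSpace.single 1 (1 : ℝ)) + z • (EuclideanSpace.single 2 (1 : ℝ))) (n • ((-T 1) • EuclideanSpace.single 0 (1 : ℝ) + T 0 • EuclideanSpace.single 1 (1 : ℝ)) + z • (EuclideanSpace.single 2 (1 : ℝ))))) y (n • ((-T 1) • EuclideanSpace.single 0 (1 : ℝ) + T 0 • EuclideanSpace.single 1 (1 : ℝ)) + z • (EuclideanSpace.single 2 (1 : ℝ))) (n • ((-T 1) • EuclideanSpace.single 0 (1 : ℝ) + T 0 • EuclideanSpace.single 1 (1 : ℝ)) + z • (EuclideanSpace.single 2 (1 : ℝ))) = 0) := by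
  obtain ⟨μ₀, hμ0, harc⟩ := arcQuarticForm_of_flatHotArc hdec hcont hmild hdiv hpol hTH hne hhot hproper hσN hflatAll hγd hγ2 hγv hunit
  refine ⟨μ₀, hμ0, fun s T hT y hyγ => ?_⟩
  obtain ⟨-, hE⟩ := harc s T hT y hyγ
  have hform := fun n z : ℝ => by
    have h := (hE n z).2
    rw [(hE n z).1] at h
    exact h
  refine ⟨?_, ?_⟩
  · have key := quartic_definite_iff hσ hμ0 hform
    refine Iff.trans ?_ key
    constructor
    · rintro ⟨lam, hlam, h⟩
      refine ⟨lam, hlam, fun n z => ?_⟩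
      have h' := h n z
      rw [(hE n z).1] at h'
      exact h'
    · rintro ⟨lam, hlam, h⟩
      refine ⟨lam, hlam, fun n z => ?_⟩
      rw [(hE n z).1]
      exact h n z
  · intro heq n z t hn hz'
    rw [(hE n z).1, hn, hz']
    exact quartic_nullLine_of_sq_eq heq t

end Summit.NavierStokesRegularity.NavierStokesRegularity.Theorems.PoloidalWindowDoorLrcModEntireTwistingTHFlatRidgeArcDefinite
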